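import Summits.ABC.IUTFork.Conditional.WRowLicenceOrbitEventuallySharpM
import Summits.ABC.IUTFork.Cor312SlotLicenceSingletonFibresM
import HarnessLib

/-!
# Branch C / R-W, reading (P), M line: the SLOT licence of the M-LEVEL setting of the datum's own ideles at EVERY genuine Θ-datum over EVERY
# RATIONAL point of the S₃-orbit of an abc-triple Frey point beyond the SHARP level (abc-iut cell, branch C, row «ORBIT-M», file B6 = orbit twin
# of B4 p522868; seat abc-iut-C-cert-2 gen 7)

Record-only PROOF file (D-0012; 0 definitions, 0 `Prop` facts, nothing re-typed) of the abc-iut cell. TAKES NO SIDE on [IUTchIII] Cor. 3.12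
(S. Mochizuki, *Inter-universal Teichmüller theory III*, Cor. 3.12 p. 173–174; Step (xi-f) p. 184) or on any author.

File B2 (`WRowM.licence_triple_of_primePow_lt`, p520076) gives the (U) licence of the M books' setting at every abc-triple datum beyond the sharp
level. At rational `j` the fibres of `V̲` over the rational primes are SINGLETONS (abc-iut-w5-d166 `fibre_eq_of_j_mem_range`), and over singleton
fibres the slot licence IS the union licence (this seat's gen-4 `slotLicence_of_licence_settingPrVolSharpM_of_subsingleton`,
`Cor312SlotLicenceSingletonFibresM`). Hence — the M twin of p512345's `WRow.slotLicence_triple_of_primePow_lt`: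

* **`WRowM.slotLicence_triple_of_primePow_lt`**, **`WRowM.slotLicence_triple_of_sq_lt`** — `SlotLicence` of
  `settingPrVolSharpM T.D hlog (tOfIdeleData T.D r) (tqM … r) …` at EVERY genuine datum of EVERY abc triple (`j ≠ 1728`) at every prime `l ≥ 5`
  with `p < l ∧ 4·p^{⌊v_p(abc)/2⌋} < l` for every odd prime `p ∣ abc` / with `16·abc < l²`, for every idele datum `r`, every analytic `logv`, every
  context datum, any `htq0/Sq/htq1`.

READING: at such data the γ-M books' antecedent `¬ SlotLicence_M` (p469493, its ζ/level-cut twins) is FALSE, like the γ-K antecedent (p512345).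
HONEST SCOPE: OUR typed slot licence (STRONGER-THAN-PRINT reading); nothing about the printed GLOBAL inequality; non-emptiness / admissibility /
Szpiro-badness NOT claimed; typed ≠ proved; instantiated ≠ endorsed; no abc claim. [cite: Mochizuki2012, IUTchI Def. 3.1 (b),(e) pp. 61–62;
IUTchIII Cor. 3.12 Step (xi-d) p. 183, (xi-f) p. 184; IUTchIV Prop. 1.2 (i)(ii) p. 10, Prop. 1.4 (ii) p. 13] [cite: DupuyHilado2025, §3.4, §4.11,
§4.12] [claim: Mochizuki2012, status: disputed] for every IUT sentence. PROOF-ONLY: no definitions.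
-/

noncomputable section

open Set Function NumberField IsDedekindDomain

namespace Summit.ABC.IUTFork.Conditional

open Thm311 Thm311.Real Cor312 Cor312Vol Cor312Prov Literature.IUT.LogThetaLattice Literature.IUT.LogVolume
  Literature.IUT.HodgeTheaters Literature.IUT.LogVolume.ThetaData Literature.IUT.LogVolume.Cor22
open Literature.NumberTheory.NumberFields Literature.NumberTheory.GaloisRepresentations.Ultrametric
open Literature.NumberTheory.DiophantineGeometry Literature.NumberTheory.DiophantineGeometry.GenEll Summit.ABC.ABC.Theorems

/-- **THE SLOT LICENCE OF THE M-LEVEL OWN-IDELES SETTING at EVERY genuine Θ-datum over EVERY rational `q` with `j(q) = j(a/c)`, EVERY prime `l ≥ 5` with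
`p < l ∧ 4·p^{⌊v_p(abc)/2⌋} < l` for every odd prime `p ∣ abc`**: file B2's union licence + singleton fibres at rational `j`
(`fibre_eq_of_j_mem_range`) + `slotLicence_of_licence_settingPrVolSharpM_of_subsingleton`. [cite: Mochizuki2012, IUTchIII Cor. 3.12 Step (xi-d)
p. 183, (xi-f) p. 184; IUTchIV Prop. 1.2 (i)(ii) p. 10] [cite: DupuyHilado2025, §4.11, §4.12] [claim: Mochizuki2012, status: disputed] -/
theorem WRowM.slotLicence_orbit_of_primePow_lt {a b c l : ℕ} (habc : IsABCTriple a b c) {q : ℚ}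
    (hq : Cor22.jInv q = Cor22.jInv ((a : ℚ) / c))
    (hl : l.Prime) (hl5 : 5 ≤ l)
    (hbad : ∀ p : ℕ, p.Prime → p ∣ a * b * c → p ≠ 2 → p < l ∧ 4 * p ^ ((a * b * c).factorization p / 2) < l)
    (T : Cor22.ThetaVolumeDatumAt (ratPoint q) l) :
    letI := T.instFieldF; letI := T.instNumberFieldF; letI := T.instAlgebraF; letI := T.instFieldK
    letI := T.instNumberFieldK; letI := T.instAlgebraK; letI := T.instFieldFbar; letI := T.instAlgebraFbar
    letI := T.instAlgebraKFbar; letI := T.instIsElliptic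
    ∀ {logvK : PadicLogsVal T.K} (hlog : LogvAnalyticVal logvK) (r : ThetaData.IdeleData T.D) (M : Type) [Field M] [NumberField M]
      (archPk : ∀ (j : (thetaIndexOfInitial T.D).Label) (vQ : (thetaIndexOfInitial T.D).VQ),
        Set ((logShellsOfInitialDH T.D logvK).Packet j vQ))
      (archSub : ∀ (j : (thetaIndexOfInitial T.D).Label) (v : (thetaIndexOfInitial T.D).V),
        Set ((logShellsOfInitialDH T.D logvK).Packet j ((thetaIndexOfInitial T.D).over v)))
      (Ψ : ℤ → ∀ v : (thetaIndexOfInitial T.D).V, v ∈ (thetaIndexOfInitial T.D).Vbad →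
        Set ((logShellsOfInitialDH T.D logvK).StarPacket v))
      (act : ℤ → ∀ v : (thetaIndexOfInitial T.D).V, v ∈ (thetaIndexOfInitial T.D).Vbad →
        (logShellsOfInitialDH T.D logvK).StarPacket v → Module.End ℚ ((logShellsOfInitialDH T.D logvK).StarPacket v))
      (Mmod : ℤ → ∀ j : (thetaIndexOfInitial T.D).LabelStar, Set ((logShellsOfInitialDH T.D logvK).GlobalPacket j.1))
      (region : ℤ → ∀ j : (thetaIndexOfInitial T.D).LabelStar, FinDivisor M → ∀ vQ : (thetaIndexOfInitial T.D).VQ,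
        Set ((logShellsOfInitialDH T.D logvK).Packet j.1 vQ))
      (n : ℤ) {HT : Type} {LogLink : HT → HT → Type} {IsFull : ∀ {s t : HT}, LogLink s t → Prop}
      (lat : LGPGaussianLogThetaLattice LogLink IsFull)
      {Frd : Type} {IsoF : Frd → Frd → Type} {Ob : Frd → Type} {realify : Frd → Frd} {Strip : Type}
      {IsoS : Strip → Strip → Type}
      {Mv : ∀ v : (thetaIndexOfInitial T.D).V, v ∈ (thetaIndexOfInitial T.D).Vbad → Type} [∀ v h, Monoid (Mv v h)]
      (sig : GlobalLGPFrobenioidSignature (thetaIndexOfInitial T.D).lstar (thetaIndexOfInitial T.D).V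
        (· ∈ (thetaIndexOfInitial T.D).Vbad) Frd IsoF Ob realify Strip IsoS Mv)
      (split : SplittingMonoids Mv) {ObΔ : Type}
      {N : ∀ v : (thetaIndexOfInitial T.D).V, v ∈ (thetaIndexOfInitial T.D).Vbad → Type} [∀ v h, Monoid (N v h)]
      (qData : QPilotData ObΔ N)
      (htq0 : ∀ (u : FinitePlace ℚ) (x : (thetaIndexOfInitial T.D).Fibre (Val.non u)),
        tqM T.D (ratChar u) u (natCast_ratChar_mem u) r x ≠ 0)
      (Sq : Finset (FinitePlace ℚ))
      (htq1 : ∀ (u : FinitePlace ℚ) (x : (thetaIndexOfInitial T.D).Fibre (Val.non u)), u ∉ Sq →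
        ‖tqM T.D (ratChar u) u (natCast_ratChar_mem u) r x‖ = 1),
      (settingPrVolSharpM T.D hlog (tOfIdeleData T.D r) (fun u x => tqM T.D (ratChar u) u (natCast_ratChar_mem u) r x) M archPk
          archSub Ψ act Mmod region n lat sig split qData htq0 Sq htq1).SlotLicence := by
  letI := T.instFieldF; letI := T.instNumberFieldF; letI := T.instAlgebraF; letI := T.instFieldK
  letI := T.instNumberFieldK; letI := T.instAlgebraK; letI := T.instFieldFbar; letI := T.instAlgebraFbar
  letI := T.instAlgebraKFbar; letI := T.instIsElliptic
  intro logvK hlog r M _ _ archPk archSub Ψ act Mmod region n HT LogLink IsFull lat Frd IsoF Ob realify Strip IsoS Mv _ sig split ObΔ N _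
    qData htq0 Sq htq1
  have hjF : T.E.j = ((jInv ((a : ℚ) / c) : ℚ) : T.F) := by
    rw [T.j_eq, show jInv (ratPoint q).x = jInv ((a : ℚ) / c) from hq]; exact eq_ratCast _ _
  have hjr : T.E.j ∈ Set.range (algebraMap ℚ T.F) := ⟨jInv ((a : ℚ) / c), by rw [hjF, eq_ratCast]⟩
  exact slotLicence_of_licence_settingPrVolSharpM_of_subsingleton T.D hlog (tOfIdeleData T.D r)
    (fun u x => tqM T.D (ratChar u) u (natCast_ratChar_mem u) r x) M archPk archSub Ψ act Mmod region n lat sig split qData htq0 Sq htq1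
    (tOfIdeleData_ne_zero T.D r) (fun u x y => fibre_eq_of_j_mem_range T.D hjr u x y)
    (WRowM.licence_orbit_of_primePow_lt habc hq hl hl5 hbad T hlog r M archPk archSub Ψ act Mmod region n lat sig split qData htq0 Sq htq1)

end Summit.ABC.IUTFork.Conditional

end
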